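import Literature.Geometry.Lorentzian.KerrRpBulk
import HarnessLib

/-!
# Shear-freeness of the Kerr–Schild null congruence: `∑_{ij} p_i p_j ∂_i ℓ_j = (r/Σ) |p̸|²`

(family `gr`; infrastructure for the far-region `r^p`-weighted estimates behind statement **gr.S24**
— the named fact `Kerr.dafermosRodnianski_pHierarchy_scri` of `KerrDecayHierarchy.lean`;
namespace `Literature.Geometry.Lorentzian.Kerr`)

The principal null congruence `ℓ` of the Kerr metric is geodesic and **shear-free** (Kerr 1963;
Kerr–Schild 1965, §2–§3; in Newman–Penrose language `σ = 0`, `ρ = −1/(r − i a cos θ)`, so that the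
expansion is `r/Σ` and the twist `a cos θ/Σ`, `Σ = r² + a² cos² θ`; Visser arXiv:0706.0622, §5).
For the spatial unit vector field `ℓ⃗` of the ingoing Kerr–Schild chart (straight lines of the flat
background, `(ℓ⃗·∇)ℓ⃗ = 0`, `KerrSchildDivergence.lean`) this says that the symmetric part of the
Jacobian `∂_i ℓ_j` restricted to `ℓ⃗^⊥` is the multiple `r/Σ` of the identity, i.e. for the quadratic
form `𝒟(p, p) = ∑_{ij} p_i p_j ∂_i ℓ_j` of `KerrRpBulk.lean` (`Kerr.nullShear`; it only sees the part
`p̸` of `p⃗` orthogonal to `ℓ⃗`, `Kerr.nullShear_eq_of_sub`):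

* `Kerr.nullShear_eq` — **`𝒟(p, p) = (r/Σ) |p̸|²`** at every point with `r > 0`, for all real `a`
  (`|p̸|² = |p⃗|² − (ℓ⃗·p⃗)²`, `Kerr.frameAngSq`). For `a = 0`: `∂_i(x_j/|x|) = (δ_{ij} − x̂_ix̂_j)/|x|`.

With this the bulk term of the `r^p` multiplier `f(r) m` of `KerrRpBulk.lean`
(`Kerr.multiplierBulk_outVector`) becomes
`K^m = 2 v (p̸·∇̸H) + (∂_{ℓ♯}H) |p̸|² + (1 − 2H)(r/Σ) u v` (`Kerr.multiplierBulk_outVector_shearFree`):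
the two `(1 − 2H)(r/Σ)|p̸|²` terms cancel, exactly as for Schwarzschild.

Ingredients: the directional derivatives of the components `ℓ_j` along an arbitrary vector `v`
(`Kerr.fderiv_nullCovectorFun_one/two/three`, quotient rule along the line `t ↦ x + t v`, extending the
coordinate-direction formulas of `KerrSchildDivergence.lean`), the directional derivative of the
radius (`Kerr.fderiv_radius_apply`), and one polynomial identity modulo the defining quartic of `r`
(a two-term `linear_combination` of `r²Σ = r⁴ + a²z²` and `Σ = 2r² − |x⃗|² + a²`). No named facts (D-0026).

## References

* R. P. Kerr, A. Schild, *A new class of vacuum solutions of the Einstein field equations* (1965),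
  §2–§3 (the congruence is geodesic and shear-free) (key `KerrSchild1965`).
* M. Visser, *The Kerr spacetime: a brief introduction*, arXiv:0706.0622, (34)–(36), §5
  (key `arXiv07060622`).
* G. Moschidis, arXiv:1509.08489 = Ann. PDE 2 (2016), §5 (the null second fundamental form `χ` in the
  `r^p` bulk) (key `Moschidis2016`).
-/

noncomputable section

open Set Filter
open scoped Topology

namespace Literature.Geometry.Lorentzian.Kerr

variable {a : ℝ} {x : E4}

/-! ### Directional derivatives of `r` and of the components of `ℓ` -/

/-- Components of the point `x + t v`. [folklore] -/
theorem add_smul_apply' (x v : E4) (t : ℝ) (μ : Fin 4) : (x + t • v) μ = x μ + t * v μ := by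
  simp

/-- **The directional derivative of the Kerr–Schild radius**:
`dr(v) = (r² (v⃗·x⃗) + a² z v³)/(rΣ)` (`∇r = (r² x⃗ + a² z e_z)/(rΣ)`, `∂_{t*} r = 0`).
[cite: arXiv07060622, (35)] -/
theorem fderiv_radius_apply (hx : 0 < radius a x) (v : E4) :
    fderiv ℝ (radius a) x v =
      (radius a x ^ 2 * (v 1 * x 1 + v 2 * x 2 + v 3 * x 3) + a ^ 2 * x 3 * v 3) /
        (radius a x * blSigma a (E4.spatial x)) := by
  have hr : radius a x ≠ 0 := hx.ne'
  have hS : blSigma a (E4.spatial x) ≠ 0 := (blSigma_spatial_pos hx).ne'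
  conv_lhs => rw [eq_sum_basisVector v]
  simp only [Fin.sum_univ_four, map_add, map_smul, smul_eq_mul, fderiv_radius_basisVector_zero a hx,
    fderiv_radius_basisVector_one hx, fderiv_radius_basisVector_two hx,
    fderiv_radius_basisVector_three hx]
  field_simp
  ring

/-- The radius along a line `t ↦ x + t v` has derivative `dr(v)` at `t = 0`. [folklore] -/
theorem hasDerivAt_radius_line' (hx : 0 < radius a x) (v : E4) :
    HasDerivAt (fun t : ℝ ↦ radius a (x + t • v)) (fderiv ℝ (radius a) x v) 0 :=
  hasDerivAt_radius_line hx v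

/-- **`∂_v ℓ₁ = ((dr(v) x + r v¹ + a v²)(r² + a²) − (r x + a y) · 2r dr(v))/(r² + a²)²`** (quotient
rule along `t ↦ x + t v`). [cite: arXiv07060622, (34)] -/
theorem fderiv_nullCovectorFun_one (hx : 0 < radius a x) (v : E4) :
    fderiv ℝ (fun y ↦ nullCovectorFun a y 1) x v =
      ((fderiv ℝ (radius a) x v * x 1 + radius a x * v 1 + a * v 2) * (radius a x ^ 2 + a ^ 2) -
        (radius a x * x 1 + a * x 2) * (2 * radius a x * fderiv ℝ (radius a) x v)) /
      (radius a x ^ 2 + a ^ 2) ^ 2 := by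
  have hQ : radius a x ^ 2 + a ^ 2 ≠ 0 := by positivity
  have hd : DifferentiableAt ℝ (fun y ↦ nullCovectorFun a y 1) x :=
    (contDiffAt_nullCovectorFun a hx (n := 1) 1).differentiableAt one_ne_zero
  have h1 : HasLineDerivAt ℝ (fun y ↦ nullCovectorFun a y 1)
      (fderiv ℝ (fun y ↦ nullCovectorFun a y 1) x v) x v :=
    hd.hasFDerivAt.hasLineDerivAt _
  refine h1.unique ?_
  show HasDerivAt (fun t : ℝ ↦ nullCovectorFun a (x + t • v) 1) _ 0
  have hr := hasDerivAt_radius_line hx v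
  have hl1 : HasDerivAt (fun t : ℝ ↦ x 1 + t * v 1) (v 1) 0 := by
    simpa using ((hasDerivAt_id (0 : ℝ)).mul_const (v 1)).const_add (x 1)
  have hl2 : HasDerivAt (fun t : ℝ ↦ x 2 + t * v 2) (v 2) 0 := by
    simpa using ((hasDerivAt_id (0 : ℝ)).mul_const (v 2)).const_add (x 2)
  have hnum : HasDerivAt
      (fun t : ℝ ↦ radius a (x + t • v) * (x 1 + t * v 1) + a * (x 2 + t * v 2))
      (fderiv ℝ (radius a) x v * (x 1 + 0 * v 1) + radius a (x + (0 : ℝ) • v) * v 1 + a * v 2) 0 :=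
    (hr.mul hl1).add (hl2.const_mul a)
  have hden : HasDerivAt (fun t : ℝ ↦ radius a (x + t • v) ^ 2 + a ^ 2)
      (↑(2 : ℕ) * radius a (x + (0 : ℝ) • v) ^ (2 - 1) * fderiv ℝ (radius a) x v) 0 :=
    (hr.pow 2).add_const (a ^ 2)
  have hdiv := hnum.div hden (by simpa using hQ)
  have hfun : (fun t : ℝ ↦ nullCovectorFun a (x + t • v) 1) = fun t ↦
      (radius a (x + t • v) * (x 1 + t * v 1) + a * (x 2 + t * v 2)) /
        (radius a (x + t • v) ^ 2 + a ^ 2) := by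
    funext t
    rw [nullCovectorFun_apply_one, add_smul_apply', add_smul_apply']
  rw [hfun]
  refine hdiv.congr_deriv ?_
  simp only [zero_smul, add_zero, Nat.cast_ofNat, zero_mul, pow_one, Nat.add_one_sub_one]

/-- **`∂_v ℓ₂ = ((dr(v) y + r v² − a v¹)(r² + a²) − (r y − a x) · 2r dr(v))/(r² + a²)²`.**
[cite: arXiv07060622, (34)] -/
theorem fderiv_nullCovectorFun_two (hx : 0 < radius a x) (v : E4) :
    fderiv ℝ (fun y ↦ nullCovectorFun a y 2) x v =
      ((fderiv ℝ (radius a) x v * x 2 + radius a x * v 2 - a * v 1) * (radius a x ^ 2 + a ^ 2) -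
        (radius a x * x 2 - a * x 1) * (2 * radius a x * fderiv ℝ (radius a) x v)) /
      (radius a x ^ 2 + a ^ 2) ^ 2 := by
  have hQ : radius a x ^ 2 + a ^ 2 ≠ 0 := by positivity
  have hd : DifferentiableAt ℝ (fun y ↦ nullCovectorFun a y 2) x :=
    (contDiffAt_nullCovectorFun a hx (n := 1) 2).differentiableAt one_ne_zero
  have h1 : HasLineDerivAt ℝ (fun y ↦ nullCovectorFun a y 2)
      (fderiv ℝ (fun y ↦ nullCovectorFun a y 2) x v) x v :=
    hd.hasFDerivAt.hasLineDerivAt _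
  refine h1.unique ?_
  show HasDerivAt (fun t : ℝ ↦ nullCovectorFun a (x + t • v) 2) _ 0
  have hr := hasDerivAt_radius_line hx v
  have hl1 : HasDerivAt (fun t : ℝ ↦ x 1 + t * v 1) (v 1) 0 := by
    simpa using ((hasDerivAt_id (0 : ℝ)).mul_const (v 1)).const_add (x 1)
  have hl2 : HasDerivAt (fun t : ℝ ↦ x 2 + t * v 2) (v 2) 0 := by
    simpa using ((hasDerivAt_id (0 : ℝ)).mul_const (v 2)).const_add (x 2)
  have hnum : HasDerivAt
      (fun t : ℝ ↦ radius a (x + t • v) * (x 2 + t * v 2) - a * (x 1 + t * v 1))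
      (fderiv ℝ (radius a) x v * (x 2 + 0 * v 2) + radius a (x + (0 : ℝ) • v) * v 2 - a * v 1) 0 :=
    (hr.mul hl2).sub (hl1.const_mul a)
  have hden : HasDerivAt (fun t : ℝ ↦ radius a (x + t • v) ^ 2 + a ^ 2)
      (↑(2 : ℕ) * radius a (x + (0 : ℝ) • v) ^ (2 - 1) * fderiv ℝ (radius a) x v) 0 :=
    (hr.pow 2).add_const (a ^ 2)
  have hdiv := hnum.div hden (by simpa using hQ)
  have hfun : (fun t : ℝ ↦ nullCovectorFun a (x + t • v) 2) = fun t ↦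
      (radius a (x + t • v) * (x 2 + t * v 2) - a * (x 1 + t * v 1)) /
        (radius a (x + t • v) ^ 2 + a ^ 2) := by
    funext t
    rw [nullCovectorFun_apply_two, add_smul_apply', add_smul_apply']
  rw [hfun]
  refine hdiv.congr_deriv ?_
  simp only [zero_smul, add_zero, Nat.cast_ofNat, zero_mul, pow_one, Nat.add_one_sub_one]

/-- **`∂_v ℓ₃ = (r v³ − z dr(v))/r²`.** [cite: arXiv07060622, (34)] -/
theorem fderiv_nullCovectorFun_three (hx : 0 < radius a x) (v : E4) :
    fderiv ℝ (fun y ↦ nullCovectorFun a y 3) x v =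
      (v 3 * radius a x - x 3 * fderiv ℝ (radius a) x v) / radius a x ^ 2 := by
  have hd : DifferentiableAt ℝ (fun y ↦ nullCovectorFun a y 3) x :=
    (contDiffAt_nullCovectorFun a hx (n := 1) 3).differentiableAt one_ne_zero
  have h1 : HasLineDerivAt ℝ (fun y ↦ nullCovectorFun a y 3)
      (fderiv ℝ (fun y ↦ nullCovectorFun a y 3) x v) x v :=
    hd.hasFDerivAt.hasLineDerivAt _
  refine h1.unique ?_
  show HasDerivAt (fun t : ℝ ↦ nullCovectorFun a (x + t • v) 3) _ 0
  have hr := hasDerivAt_radius_line hx v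
  have hnum : HasDerivAt (fun t : ℝ ↦ x 3 + t * v 3) (v 3) 0 := by
    simpa using ((hasDerivAt_id (0 : ℝ)).mul_const (v 3)).const_add (x 3)
  have hdiv := hnum.div hr (by simpa using hx.ne')
  have hfun : (fun t : ℝ ↦ nullCovectorFun a (x + t • v) 3) = fun t ↦
      (x 3 + t * v 3) / radius a (x + t • v) := by
    funext t
    rw [nullCovectorFun_apply_three, add_smul_apply']
  rw [hfun]
  refine hdiv.congr_deriv ?_
  simp only [zero_smul, add_zero, zero_mul]

/-! ### The shear-freeness identity -/

/-- The spatial vector `p⃗ = (0, p₁, p₂, p₃)` of a covector `p`. [folklore] -/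
def spatialVec (p : Fin 4 → ℝ) : E4 := ∑ i : Fin 3, p i.succ • E4.basisVector i.succ

/-- Components of `p⃗`: time component `0`. [folklore] -/
@[simp]
theorem spatialVec_apply_zero (p : Fin 4 → ℝ) : spatialVec p 0 = 0 := by
  simp [spatialVec, Fin.sum_univ_three, E4.basisVector]

/-- Components of `p⃗`: `(p⃗)¹ = p₁`. [folklore] -/
@[simp]
theorem spatialVec_apply_one (p : Fin 4 → ℝ) : spatialVec p 1 = p 1 := by
  simp [spatialVec, Fin.sum_univ_three, E4.basisVector]

/-- Components of `p⃗`: `(p⃗)² = p₂`. [folklore] -/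
@[simp]
theorem spatialVec_apply_two (p : Fin 4 → ℝ) : spatialVec p 2 = p 2 := by
  simp [spatialVec, Fin.sum_univ_three, E4.basisVector]

/-- Components of `p⃗`: `(p⃗)³ = p₃`. [folklore] -/
@[simp]
theorem spatialVec_apply_three (p : Fin 4 → ℝ) : spatialVec p 3 = p 3 := by
  simp [spatialVec, Fin.sum_univ_three, E4.basisVector]

/-- `𝒟(p, p) = ∑_j p_j ∂_{p⃗} ℓ_j`: the shear form as a single directional derivative along `p⃗`
(linearity of the derivative in the direction). [folklore] -/
theorem nullShear_eq_sum_fderiv_spatialVec (a : ℝ) (x : E4) (p : Fin 4 → ℝ) :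
    nullShear a x p = ∑ j : Fin 3, p j.succ * fderiv ℝ (fun y ↦ nullCovectorFun a y j.succ) x (spatialVec p) := by
  rw [nullShear, Finset.sum_comm]
  refine Finset.sum_congr rfl fun j _ ↦ ?_
  rw [spatialVec, map_sum, Finset.mul_sum]
  exact Finset.sum_congr rfl fun i _ ↦ by rw [map_smul, smul_eq_mul]; ring

/-- **Shear-freeness of the Kerr–Schild congruence, as a quadratic-form identity**:
`𝒟(p, p) = ∑_{ij} p_i p_j ∂_iℓ_j = (r/Σ) (|p⃗|² − (ℓ⃗·p⃗)²) = (r/Σ)|p̸|²` wherever `r > 0`, for all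
real `a` (the symmetric part of `∇ℓ⃗` on `ℓ⃗^⊥` is `(r/Σ)·id`: expansion `r/Σ`, no shear; the
antisymmetric part, the twist `a cos θ/Σ`, is invisible to the quadratic form). Kerr–Schild 1965,
§2–§3; Visser arXiv:0706.0622, §5. [cite: KerrSchild1965, §3] -/
theorem nullShear_eq (hx : 0 < radius a x) (p : Fin 4 → ℝ) :
    nullShear a x p = radius a x / blSigma a (E4.spatial x) * frameAngSq a x p := by
  rw [nullShear_eq_sum_fderiv_spatialVec, Fin.sum_univ_three]
  simp only [Fin.succ_zero_eq_one, Fin.succ_one_eq_two, fin_succ_two_eq_three]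
  rw [fderiv_nullCovectorFun_one hx, fderiv_nullCovectorFun_two hx, fderiv_nullCovectorFun_three hx,
    fderiv_radius_apply hx]
  simp only [spatialVec_apply_one, spatialVec_apply_two, spatialVec_apply_three, frameAngSq,
    spatialDotNull_eq, Fin.sum_univ_three, Fin.succ_zero_eq_one, Fin.succ_one_eq_two,
    fin_succ_two_eq_three, nullCovectorFun_apply_one, nullCovectorFun_apply_two,
    nullCovectorFun_apply_three]
  have h1 := sq_mul_blSigma_spatial a x
  have h2 : blSigma a (E4.spatial x) = 2 * radius a x ^ 2 - (x 1 ^ 2 + x 2 ^ 2 + x 3 ^ 2) + a ^ 2 := by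
    rw [blSigma_spatial_eq, E4.spatialNorm_sq]
  set r := radius a x with hr_def
  set S := blSigma a (E4.spatial x) with hS_def
  have hr : r ≠ 0 := hx.ne'
  have hS : S ≠ 0 := (blSigma_spatial_pos hx).ne'
  have hQ : r ^ 2 + a ^ 2 ≠ 0 := by positivity
  set X := x 1 with hX
  set Y := x 2 with hY
  set Z := x 3 with hZ
  set P1 := p 1 with hP1
  set P2 := p 2 with hP2
  set P3 := p 3 with hP3
  field_simp
  linear_combination (r ^ 4 * P1 ^ 2 + r ^ 4 * P2 ^ 2 + r ^ 4 * P3 ^ 2 + 2 * r ^ 2 * a ^ 2 * P3 ^ 2 +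
    a ^ 4 * P3 ^ 2) * h1 + (r ^ 4 * a ^ 2 * P1 ^ 2 + r ^ 4 * a ^ 2 * P2 ^ 2) * h2

/-! ### The bulk of the outgoing null vector, shear-free form -/

/-- **The bulk term of `m` on Kerr, with the shear-freeness inserted**:
`K^m = 2 v (p̸·dH̸) + (∂_{ℓ♯}H) |p̸|² + (1 − 2H)(2r/Σ) · ½ · u v` — the `|p̸|²`-terms
`(1 − 2H) 𝒟(p,p) − (1 − 2H)(r/Σ)|p̸|²` of `Kerr.multiplierBulk_outVector` cancel. Hence for
`X = f(r) m` (`Kerr.multiplierBulk_radial_smul_outVector`):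
`K^{fm} = ½ f′ u² + (f H_ℓ − ½(1 − 2H) f′) |p̸|² + (1 − 2H)(r/Σ) f u v + f′ u (p̸·∇̸r) + 2 f v (p̸·∇̸H)`,
`H_ℓ = ∂_{ℓ♯}H = M(Σ − 2r²)/Σ²`. For `a = 0` (`Σ = r²`, `H_ℓ = −M/r²`, `∇̸r = ∇̸H = 0`) and `f = r^p`
this is `½ p r^{p−1} u² − (M r^{p−2} + ½ (1 − 2M/r) p r^{p−1}) |∇̸ψ|² + (1 − 2M/r) r^{p−1} u v`.
[cite: DafermosRodnianski2010ICMP, §4] -/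
theorem multiplierBulk_outVector_shearFree (M : ℝ) (hx : 0 < radius a x) (w : E4 → ℝ) :
    KerrSchild.multiplierBulk (inverseMetric M a) (fun y μ ↦ outVector M a y μ) w x =
      2 * frameIn a x (fun μ ↦ fderiv ℝ w x (E4.basisVector μ)) *
          frameAng a x (fun μ ↦ fderiv ℝ w x (E4.basisVector μ))
            (fun μ ↦ fderiv ℝ (scalarH M a) x (E4.basisVector μ)) +
        fderiv ℝ (scalarH M a) x (nullVector a x) *
          frameAngSq a x (fun μ ↦ fderiv ℝ w x (E4.basisVector μ)) +
        (1 - 2 * scalarH M a x) * (2 * radius a x / blSigma a (E4.spatial x)) * 2⁻¹ *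
          (frameOut M a x (fun μ ↦ fderiv ℝ w x (E4.basisVector μ)) *
            frameIn a x (fun μ ↦ fderiv ℝ w x (E4.basisVector μ))) := by
  rw [multiplierBulk_outVector M a hx, nullShear_eq hx]
  ring

end Literature.Geometry.Lorentzian.Kerr
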